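import Mathlib
import HarnessLib
import Summits.QuantumFields.YangMills.Theorems.LangevinControlUVFemtoCurvatureSkewnessTreeRatioFloorBinomial
import Summits.QuantumFields.YangMills.Theorems.LangevinControlUVFemtoCurvatureSkewnessTreeRatioFloorBlock
import Summits.QuantumFields.YangMills.Theorems.LangevinControlUVFemtoCurvatureSkewnessTreeRatioFloorKernel

/-!
# `FemtoCurvatureSkewness` — bounds on the periodised lazy kernel (stub `TreeRatioFloor`, crux stmt-QuantumFields-9365)

Two quantitative facts about `λ_i(y) = 4^{-i} Σ_{s ≤ 2i, L ∣ s-i-y} C(2i,s)` on the circle `ℤ/L`: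

* **ratio floor** (`lam_zero_le_exp_four_mul`): `λ_i(0) ≤ e⁴ λ_i(n)` for `1 ≤ n`, `n² ≤ i`, `2n ≤ L` — the centre
  `s = i` is compared with `s = i + n` (`C(2i,i) ≤ e⁴ C(2i,i+n)`), every wrapped term `s = i ± tL`, `t ≠ 0`, is moved
  `n` steps towards the centre into the class of `n` (an at most two-to-one map);
* **Gaussian bound** (`lam_le_gauss`): `λ_i(y) ≤ 4 p_i exp(-y²/(2i))`, `p_i = C(2i,i)/4^i`, for `16 i ≤ L²`,
  `2|y| ≤ L` — each term is at most `p_i exp(-(s-i)²/(2i))`, `s - i = y + tL`, the three terms `|t| ≤ 1` are at most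
  `exp(-y²/(2i))` each and the others are summable with total weight `≤ 1`.
-/

noncomputable section

namespace Summit.QuantumFields.YangMills.Theorems.FemtoCurvatureSkewness

open Finset
open scoped BigOperators

namespace TreeRatio

variable (L : ℕ)

/-! ## The ratio floor -/

/-- **Ratio floor for the periodised lazy kernel**: `λ_i(0) ≤ e⁴ λ_i(n)` for `1 ≤ n`, `n² ≤ i`, `2n ≤ L`. -/
theorem lam_zero_le_exp_four_mul {i n : ℕ} (hn : 1 ≤ n) (hi : n ^ 2 ≤ i) (hL : 2 * n ≤ L) :
    lam L i 0 ≤ Real.exp 4 * lam L i n := by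
  have hni : n ≤ i := le_trans (by nlinarith) hi
  set S0 : Finset ℕ := lamSet L i 0 with hS0
  set Sn : Finset ℕ := lamSet L i n with hSn
  -- the transport map
  let ψ : ℕ → ℕ := fun s => if s ≤ i then s + n else 2 * i + n - s
  have memS0 : ∀ s ∈ S0, s ≤ 2 * i ∧ (L : ℤ) ∣ (s : ℤ) - i := by
    intro s hs
    simp only [hS0, lamSet, mem_filter, mem_range, sub_zero] at hs
    exact ⟨by omega, hs.2⟩
  have far : ∀ s ∈ S0, s ≠ i → (2 * n : ℤ) ≤ |(s : ℤ) - i| := by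
    intro s hs hsi
    have hne : (s : ℤ) - i ≠ 0 := by omega
    have h := Int.le_of_dvd (abs_pos.mpr hne) ((dvd_abs _ _).mpr (memS0 s hs).2)
    omega
  have hψmem : ∀ s ∈ S0, ψ s ∈ Sn := by
    intro s hs
    obtain ⟨hs2, hdvd⟩ := memS0 s hs
    simp only [hSn, lamSet, mem_filter, mem_range]
    by_cases hsi : s ≤ i
    · simp only [ψ, if_pos hsi]
      refine ⟨by omega, ?_⟩
      have : ((s + n : ℕ) : ℤ) - i - (n : ℕ) = (s : ℤ) - i := by push_cast; ring
      rwa [this]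
    · simp only [ψ, if_neg hsi]
      refine ⟨by omega, ?_⟩
      have : ((2 * i + n - s : ℕ) : ℤ) - i - (n : ℕ) = -((s : ℤ) - i) := by
        rw [Nat.cast_sub (by omega)]; push_cast; ring
      rw [this]
      exact (dvd_neg).mpr hdvd
  have hψmono : ∀ s ∈ S0, s ≠ i → ((2 * i).choose s : ℝ) ≤ (2 * i).choose (ψ s) := by
    intro s hs hsi
    have hfar := far s hs hsi
    obtain ⟨hs2, _⟩ := memS0 s hs
    have hnat : (2 * i).choose s ≤ (2 * i).choose (ψ s) := by
      refine choose_le_choose_of_abs_le i s (ψ s) ?_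
      by_cases hsi' : s ≤ i
      · simp only [ψ, if_pos hsi']
        rw [abs_of_nonpos (by omega : (s : ℤ) - i ≤ 0)] at hfar ⊢
        push_cast
        rw [abs_of_nonpos (by omega)]
        omega
      · simp only [ψ, if_neg hsi']
        rw [abs_of_nonneg (by omega : (0 : ℤ) ≤ (s : ℤ) - i)] at hfar ⊢
        rw [Nat.cast_sub (by omega)]
        push_cast
        rw [abs_of_nonpos (by omega)]
        omega
    exact_mod_cast hnat
  -- fibres of `ψ` have at most two points
  have hfib : ∀ k ∈ (S0.erase i).image ψ, ((S0.erase i).filter (fun s => ψ s = k)).card ≤ 2 := by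
    intro k _
    calc ((S0.erase i).filter (fun s => ψ s = k)).card ≤ ({k - n, 2 * i + n - k} : Finset ℕ).card := by
          refine card_le_card fun s hs => ?_
          simp only [mem_filter] at hs
          simp only [mem_insert, mem_singleton]
          by_cases hsi : s ≤ i
          · simp only [ψ, if_pos hsi] at hs; omega
          · simp only [ψ, if_neg hsi] at hs
            have := (memS0 s (mem_of_mem_erase hs.1)).1
            omega
      _ ≤ 2 := card_le_two
  -- the image misses the centre class representative `i + n`
  have hmiss : i + n ∉ (S0.erase i).image ψ := by
    intro h
    obtain ⟨s, hs, hψs⟩ := mem_image.mp h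
    have hsi : s ≠ i := (mem_erase.mp hs).1
    by_cases hsi' : s ≤ i
    · simp only [ψ, if_pos hsi'] at hψs; omega
    · simp only [ψ, if_neg hsi'] at hψs
      have := (memS0 s (mem_of_mem_erase hs)).1
      omega
  have hsub : insert (i + n) ((S0.erase i).image ψ) ⊆ Sn := by
    intro k hk
    rcases mem_insert.mp hk with rfl | hk
    · simp only [hSn, lamSet, mem_filter, mem_range]
      refine ⟨by omega, ?_⟩
      have : ((i + n : ℕ) : ℤ) - i - (n : ℕ) = 0 := by push_cast; ring
      rw [this]; exact dvd_zero _
    · obtain ⟨s, hs, rfl⟩ := mem_image.mp hk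
      exact hψmem s (mem_of_mem_erase hs)
  have hiS0 : i ∈ S0 := by
    simp only [hS0, lamSet, mem_filter, mem_range]
    exact ⟨by omega, by simp⟩
  -- numerical constants
  have he : Real.exp (-4) ≤ 1 / 2 := by
    have h5 : (5 : ℝ) ≤ Real.exp 4 := by have := Real.add_one_le_exp 4; linarith
    rw [Real.exp_neg, inv_eq_one_div, div_le_div_iff₀ (Real.exp_pos 4) two_pos]
    linarith
  have hcenter : Real.exp (-4) * ((2 * i).choose i : ℝ) ≤ (2 * i).choose (i + n) := by
    have h := choose_center_le_exp_four_mul hn hi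
    rw [Real.exp_neg, inv_mul_le_iff₀ (Real.exp_pos 4)]
    exact h
  -- the main chain, on the numerators
  have key : Real.exp (-4) * ∑ s ∈ S0, ((2 * i).choose s : ℝ) ≤ ∑ s ∈ Sn, ((2 * i).choose s : ℝ) := by
    have hdecomp := (add_sum_erase S0 (fun s => ((2 * i).choose s : ℝ)) hiS0)
    calc Real.exp (-4) * ∑ s ∈ S0, ((2 * i).choose s : ℝ)
        = Real.exp (-4) * ((2 * i).choose i : ℝ) + Real.exp (-4) * ∑ s ∈ S0.erase i, ((2 * i).choose s : ℝ) := by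
          rw [← hdecomp, mul_add]
      _ ≤ (2 * i).choose (i + n) + (1 / 2) * ∑ s ∈ S0.erase i, ((2 * i).choose s : ℝ) := by
          gcongr
      _ ≤ (2 * i).choose (i + n) + (1 / 2) * ∑ s ∈ S0.erase i, ((2 * i).choose (ψ s) : ℝ) := by
          gcongr with s hs
          exact_mod_cast hψmono s (mem_of_mem_erase hs) (mem_erase.mp hs).1
      _ ≤ (2 * i).choose (i + n) + (1 / 2) * (2 * ∑ k ∈ (S0.erase i).image ψ, ((2 * i).choose k : ℝ)) := by
          gcongr
          exact sum_comp_le_two_mul (S0.erase i) ψ (fun k => ((2 * i).choose k : ℝ)) (fun _ => by positivity) hfib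
      _ = ∑ k ∈ insert (i + n) ((S0.erase i).image ψ), ((2 * i).choose k : ℝ) := by
          rw [sum_insert hmiss]; ring
      _ ≤ ∑ s ∈ Sn, ((2 * i).choose s : ℝ) := sum_le_sum_of_subset_of_nonneg hsub (fun _ _ _ => by positivity)
  -- divide by `4^i`
  unfold lam
  rw [← hS0, ← hSn]
  have h4 : (0 : ℝ) < 4 ^ i := by positivity
  rw [mul_div_assoc', div_le_div_iff_of_pos_right h4]
  calc ∑ s ∈ S0, ((2 * i).choose s : ℝ) = Real.exp 4 * (Real.exp (-4) * ∑ s ∈ S0, ((2 * i).choose s : ℝ)) := by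
        rw [← mul_assoc, ← Real.exp_add]; norm_num
    _ ≤ Real.exp 4 * ∑ s ∈ Sn, ((2 * i).choose s : ℝ) := mul_le_mul_of_nonneg_left key (Real.exp_pos _).le

/-! ## The Gaussian bound -/

/-- Unwrapped images: for `2|y| ≤ L` and `|t| ≤ 1`, `(y + tL)² ≥ y²`. -/
theorem sq_le_sq_add_mul_of_abs_le_one {L : ℕ} {y t : ℤ} (hy : 2 * |y| ≤ L) (ht : |t| ≤ 1) :
    ((y : ℝ)) ^ 2 ≤ ((y : ℝ) + t * L) ^ 2 := by
  have hy' : 2 * |(y : ℝ)| ≤ L := by exact_mod_cast hy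
  rcases (show t = -1 ∨ t = 0 ∨ t = 1 by rcases abs_le.mp ht with ⟨h1, h2⟩; omega) with rfl | rfl | rfl
  · push_cast
    cases abs_cases (y : ℝ) <;> nlinarith
  · simp
  · push_cast
    cases abs_cases (y : ℝ) <;> nlinarith

/-- Far images: for `2|y| ≤ L` and `|t| ≥ 2`, `(y + tL)² ≥ y² + t²L²/2`. -/
theorem sq_add_le_sq_add_mul_of_two_le_abs {L : ℕ} {y t : ℤ} (hy : 2 * |y| ≤ L) (ht : 2 ≤ |t|) :
    ((y : ℝ)) ^ 2 + (t : ℝ) ^ 2 * (L : ℝ) ^ 2 / 2 ≤ ((y : ℝ) + t * L) ^ 2 := by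
  have hy' : 2 * |(y : ℝ)| ≤ L := by exact_mod_cast hy
  have hL : (0 : ℝ) ≤ L := Nat.cast_nonneg L
  have hy1 : -(L : ℝ) ≤ 2 * y := by cases abs_cases (y : ℝ) <;> linarith
  have hy2 : 2 * (y : ℝ) ≤ L := by cases abs_cases (y : ℝ) <;> linarith
  have key : ((y : ℝ) + t * L) ^ 2 = (y : ℝ) ^ 2 + (t : ℝ) ^ 2 * (L : ℝ) ^ 2 / 2 + (t * L) * (2 * y + t * L / 2) := by
    ring
  rw [key]
  rcases le_or_gt 0 t with h | h
  · rw [abs_of_nonneg h] at ht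
    have ht' : (2 : ℝ) ≤ t := by exact_mod_cast ht
    have h1 : (0 : ℝ) ≤ t * L := mul_nonneg (by linarith) hL
    have h2 : (0 : ℝ) ≤ 2 * y + t * L / 2 := by nlinarith
    nlinarith [mul_nonneg h1 h2]
  · rw [abs_of_neg h] at ht
    have ht' : (t : ℝ) ≤ -2 := by
      have h' := (Int.cast_le (R := ℝ)).mpr ht
      push_cast at h'
      linarith
    have h1 : (t : ℝ) * L ≤ 0 := mul_nonpos_of_nonpos_of_nonneg (by linarith) hL
    have h2 : 2 * (y : ℝ) + t * L / 2 ≤ 0 := by nlinarith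
    nlinarith [mul_nonneg_of_nonpos_of_nonpos h1 h2]

/-- `exp(-4t²) ≤ (1/4)(1/2)^{|t|}` for every nonzero integer `t`. -/
theorem exp_neg_four_sq_le (t : ℤ) (ht : t ≠ 0) :
    Real.exp (-4 * (t : ℝ) ^ 2) ≤ (1 / 4) * (1 / 2) ^ t.natAbs := by
  set a : ℕ := t.natAbs with ha
  have ha1 : 1 ≤ a := Int.natAbs_pos.mpr ht
  have hta : (t : ℝ) ^ 2 = (a : ℝ) ^ 2 := by
    rw [ha, Nat.cast_natAbs, Int.cast_abs, sq_abs]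
  -- `exp(4a²) ≥ 2^{4a²} ≥ 2^{a+2}`
  have h2e : (2 : ℝ) ≤ Real.exp 1 := by have := Real.add_one_le_exp 1; norm_num at this ⊢; linarith
  have hexp : (2 : ℝ) ^ (a + 2) ≤ Real.exp (4 * (t : ℝ) ^ 2) := by
    calc (2 : ℝ) ^ (a + 2) ≤ 2 ^ (4 * a ^ 2) := pow_le_pow_right₀ (by norm_num) (by nlinarith)
      _ ≤ Real.exp 1 ^ (4 * a ^ 2) := pow_le_pow_left₀ (by norm_num) h2e _
      _ = Real.exp (4 * (t : ℝ) ^ 2) := by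
          rw [← Real.exp_nat_mul, hta]; push_cast; ring_nf
  have hpos : (0 : ℝ) < 2 ^ (a + 2) := by positivity
  rw [show -4 * (t : ℝ) ^ 2 = -(4 * (t : ℝ) ^ 2) by ring, Real.exp_neg]
  calc (Real.exp (4 * (t : ℝ) ^ 2))⁻¹ ≤ ((2 : ℝ) ^ (a + 2))⁻¹ := by
        exact inv_anti₀ hpos hexp
    _ = (1 / 4) * (1 / 2) ^ a := by rw [pow_add, one_div_pow]; field_simp; norm_num

/-- The total weight of the far images is at most one: `Σ_{t ∈ T, |t| ≥ 2} (1/4)(1/2)^{|t|} ≤ 1` for finite `T ⊂ ℤ`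
(indeed for any finite `T` avoiding `0`). -/
theorem sum_quarter_half_pow_le_one (T : Finset ℤ) :
    ∑ t ∈ T.filter (fun t => t ≠ 0), (1 / 4 : ℝ) * (1 / 2) ^ t.natAbs ≤ 1 := by
  set T' := T.filter (fun t => t ≠ 0) with hT'
  have hfib : ∀ u ∈ T'.image Int.natAbs, (T'.filter (fun t => Int.natAbs t = u)).card ≤ 2 := by
    intro u _
    calc (T'.filter (fun t => Int.natAbs t = u)).card ≤ ({(u : ℤ), -(u : ℤ)} : Finset ℤ).card := by
          refine card_le_card fun t ht => ?_
          simp only [mem_filter] at ht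
          simp only [mem_insert, mem_singleton]
          rcases Int.natAbs_eq t with h | h <;> [left; right] <;> rw [h, ht.2]
      _ ≤ 2 := card_le_two
  have h1 := sum_comp_le_two_mul T' Int.natAbs (fun u => (1 / 4 : ℝ) * (1 / 2) ^ u) (fun _ => by positivity) hfib
  have h2 : ∑ u ∈ T'.image Int.natAbs, (1 / 4 : ℝ) * (1 / 2) ^ u ≤ 1 / 2 := by
    obtain ⟨N, hN⟩ : ∃ N, T'.image Int.natAbs ⊆ range N :=
      ⟨(T'.image Int.natAbs).sup id + 1, fun u hu => mem_range.mpr (Nat.lt_succ_of_le (le_sup (f := id) hu))⟩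
    calc ∑ u ∈ T'.image Int.natAbs, (1 / 4 : ℝ) * (1 / 2) ^ u ≤ ∑ u ∈ range N, (1 / 4 : ℝ) * (1 / 2) ^ u :=
          sum_le_sum_of_subset_of_nonneg hN (fun _ _ _ => by positivity)
      _ = (1 / 4) * ∑ u ∈ range N, (1 / 2 : ℝ) ^ u := by rw [mul_sum]
      _ ≤ (1 / 4) * 2 := by gcongr; exact sum_geometric_two_le N
      _ = 1 / 2 := by norm_num
  linarith

/-- **Gaussian bound for the periodised lazy kernel**: `λ_i(y) ≤ 4 p_i exp(-y²/(2i))` for `16 i ≤ L²`, `2|y| ≤ L`. -/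
theorem lam_le_gauss {i : ℕ} {y : ℤ} (hi : 16 * i ≤ L ^ 2) (hy : 2 * |y| ≤ L) :
    lam L i y ≤ 4 * (((2 * i).choose i : ℝ) / 4 ^ i) * Real.exp (-((y : ℝ) ^ 2) / (2 * i)) := by
  rcases Nat.eq_zero_or_pos i with h0 | hipos
  · -- `i = 0`: `λ ≤ 1 ≤ 4`
    subst h0
    have h1 := lam_le_one L 0 y
    simp only [Nat.choose_self, Nat.cast_one, pow_zero, div_one, mul_one, Nat.cast_zero,
      mul_zero, div_zero, Real.exp_zero]
    linarith
  have hireal : (0 : ℝ) < i := by exact_mod_cast hipos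
  set S := lamSet L i y with hS
  set e0 : ℝ := Real.exp (-((y : ℝ) ^ 2) / (2 * i)) with he0
  -- Step 1: termwise Gaussian bound
  have step1 : ∑ s ∈ S, ((2 * i).choose s : ℝ) ≤
      ((2 * i).choose i : ℝ) * ∑ s ∈ S, Real.exp (-(((s : ℝ) - i) ^ 2) / (2 * i)) := by
    rw [mul_sum]
    refine sum_le_sum fun s hs => ?_
    have hs2 : s ≤ 2 * i := by
      have := (mem_filter.mp hs).1; rw [mem_range] at this; omega
    exact choose_le_center_mul_exp i s hs2
  -- Step 2: reindex by the winding number `t = (s - i - y)/L`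
  let τ : ℕ → ℤ := fun s => ((s : ℤ) - i - y) / L
  have hτ : ∀ s ∈ S, (s : ℤ) - i = y + τ s * L := by
    intro s hs
    have hdvd : (L : ℤ) ∣ (s : ℤ) - i - y := (mem_filter.mp hs).2
    have := Int.ediv_mul_cancel hdvd
    simp only [τ]
    linarith
  have hinj : Set.InjOn τ S := by
    intro s hs s' hs' h
    have h1 := hτ s hs
    have h2 := hτ s' hs'
    have : (s : ℤ) = s' := by rw [h] at h1; linarith
    exact_mod_cast this
  have step2 : ∑ s ∈ S, Real.exp (-(((s : ℝ) - i) ^ 2) / (2 * i)) =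
      ∑ t ∈ S.image τ, Real.exp (-(((y : ℝ) + t * L) ^ 2) / (2 * i)) := by
    rw [sum_image hinj]
    refine sum_congr rfl fun s hs => ?_
    have h := hτ s hs
    have h' : (s : ℝ) - i = (y : ℝ) + (τ s : ℝ) * L := by exact_mod_cast h
    rw [h']
  -- Step 3: bound the sum over winding numbers
  have step3 : ∀ T : Finset ℤ, ∑ t ∈ T, Real.exp (-(((y : ℝ) + t * L) ^ 2) / (2 * i)) ≤ 4 * e0 := by
    intro T
    have hL2 : (4 : ℝ) ≤ (L : ℝ) ^ 2 / (4 * i) := by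
      rw [le_div_iff₀ (by positivity)]
      have : ((16 * i : ℕ) : ℝ) ≤ ((L ^ 2 : ℕ) : ℝ) := by exact_mod_cast hi
      push_cast at this
      linarith
    -- near images
    have hnear : ∑ t ∈ T.filter (fun t => |t| ≤ 1), Real.exp (-(((y : ℝ) + t * L) ^ 2) / (2 * i)) ≤ 3 * e0 := by
      calc ∑ t ∈ T.filter (fun t => |t| ≤ 1), Real.exp (-(((y : ℝ) + t * L) ^ 2) / (2 * i))
          ≤ ∑ t ∈ T.filter (fun t => |t| ≤ 1), e0 := by
            refine sum_le_sum fun t ht => ?_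
            have ht' : |t| ≤ 1 := (mem_filter.mp ht).2
            rw [he0]
            refine Real.exp_le_exp.mpr ?_
            rw [neg_div, neg_div, neg_le_neg_iff]
            exact div_le_div_of_nonneg_right (sq_le_sq_add_mul_of_abs_le_one hy ht') (by positivity)
        _ = (T.filter (fun t => |t| ≤ 1)).card * e0 := by rw [sum_const, nsmul_eq_mul]
        _ ≤ 3 * e0 := by
            have he0' : 0 ≤ e0 := by rw [he0]; positivity
            have hcard : ((T.filter (fun t => |t| ≤ 1)).card : ℝ) ≤ 3 := by
              have hsub : T.filter (fun t => |t| ≤ 1) ⊆ Icc (-1) 1 := by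
                intro t ht
                have := (mem_filter.mp ht).2
                rw [abs_le] at this
                exact mem_Icc.mpr this
              have := card_le_card hsub
              simp only [Int.card_Icc] at this
              exact_mod_cast this
            exact mul_le_mul_of_nonneg_right hcard he0'
    -- far images
    have hfar : ∑ t ∈ T.filter (fun t => ¬ |t| ≤ 1), Real.exp (-(((y : ℝ) + t * L) ^ 2) / (2 * i)) ≤ e0 := by
      calc ∑ t ∈ T.filter (fun t => ¬ |t| ≤ 1), Real.exp (-(((y : ℝ) + t * L) ^ 2) / (2 * i))
          ≤ ∑ t ∈ T.filter (fun t => ¬ |t| ≤ 1), e0 * ((1 / 4 : ℝ) * (1 / 2) ^ t.natAbs) := by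
            refine sum_le_sum fun t ht => ?_
            have ht' : 2 ≤ |t| := by have := (mem_filter.mp ht).2; omega
            have ht0 : t ≠ 0 := by intro h; rw [h] at ht'; simp at ht'
            have hsq := sq_add_le_sq_add_mul_of_two_le_abs hy ht'
            calc Real.exp (-(((y : ℝ) + t * L) ^ 2) / (2 * i))
                ≤ Real.exp (-((y : ℝ) ^ 2) / (2 * i) + -4 * (t : ℝ) ^ 2) := by
                  refine Real.exp_le_exp.mpr ?_
                  have h1 : -(((y : ℝ) + t * L) ^ 2) / (2 * i) ≤ -((y : ℝ) ^ 2 + (t : ℝ) ^ 2 * (L : ℝ) ^ 2 / 2) / (2 * i) := by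
                    rw [neg_div, neg_div, neg_le_neg_iff]
                    exact div_le_div_of_nonneg_right hsq (by positivity)
                  have h2 : -((y : ℝ) ^ 2 + (t : ℝ) ^ 2 * (L : ℝ) ^ 2 / 2) / (2 * i) =
                      -((y : ℝ) ^ 2) / (2 * i) - (t : ℝ) ^ 2 * ((L : ℝ) ^ 2 / (4 * i)) := by
                    field_simp; ring
                  have h3 : (t : ℝ) ^ 2 * 4 ≤ (t : ℝ) ^ 2 * ((L : ℝ) ^ 2 / (4 * i)) :=
                    mul_le_mul_of_nonneg_left hL2 (sq_nonneg _)
                  linarith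
              _ = e0 * Real.exp (-4 * (t : ℝ) ^ 2) := by rw [Real.exp_add, he0]
              _ ≤ e0 * ((1 / 4 : ℝ) * (1 / 2) ^ t.natAbs) :=
                  mul_le_mul_of_nonneg_left (exp_neg_four_sq_le t ht0) (Real.exp_pos _).le
        _ = e0 * ∑ t ∈ T.filter (fun t => ¬ |t| ≤ 1), ((1 / 4 : ℝ) * (1 / 2) ^ t.natAbs) := by rw [mul_sum]
        _ ≤ e0 * 1 := by
            refine mul_le_mul_of_nonneg_left ?_ (Real.exp_pos _).le
            have hsub : T.filter (fun t => ¬ |t| ≤ 1) ⊆ (T.filter (fun t => ¬ |t| ≤ 1)).filter (fun t => t ≠ 0) := by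
              intro t ht
              refine mem_filter.mpr ⟨ht, ?_⟩
              have := (mem_filter.mp ht).2
              intro h; rw [h] at this; simp at this
            calc ∑ t ∈ T.filter (fun t => ¬ |t| ≤ 1), ((1 / 4 : ℝ) * (1 / 2) ^ t.natAbs)
                ≤ ∑ t ∈ (T.filter (fun t => ¬ |t| ≤ 1)).filter (fun t => t ≠ 0), ((1 / 4 : ℝ) * (1 / 2) ^ t.natAbs) :=
                  sum_le_sum_of_subset_of_nonneg hsub (fun _ _ _ => by positivity)
              _ ≤ 1 := sum_quarter_half_pow_le_one _
        _ = e0 := mul_one _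
    rw [← sum_filter_add_sum_filter_not T (fun t => |t| ≤ 1)]
    linarith
  -- assemble
  have hp : (0 : ℝ) ≤ ((2 * i).choose i : ℝ) := by positivity
  unfold lam
  rw [← hS]
  calc (∑ s ∈ S, ((2 * i).choose s : ℝ)) / 4 ^ i
      ≤ (((2 * i).choose i : ℝ) * ∑ s ∈ S, Real.exp (-(((s : ℝ) - i) ^ 2) / (2 * i))) / 4 ^ i :=
        div_le_div_of_nonneg_right step1 (by positivity)
    _ ≤ (((2 * i).choose i : ℝ) * (4 * e0)) / 4 ^ i := by
        refine div_le_div_of_nonneg_right (mul_le_mul_of_nonneg_left ?_ hp) (by positivity)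
        rw [step2]
        exact step3 _
    _ = 4 * (((2 * i).choose i : ℝ) / 4 ^ i) * e0 := by ring

end TreeRatio

/-- **Ratio floor of the periodised lazy kernel** (registered sub-goal `TreeRatioKernelRatio`): `λ_i(0) ≤ e⁴ λ_i(n)` for `1 ≤ n`, `n² ≤ i`, `2n ≤ L`, with `λ` written out. -/
theorem TreeRatioKernelRatio : ∀ (L i n : ℕ), 1 ≤ n → n ^ 2 ≤ i → 2 * n ≤ L → (∑ s ∈ (Finset.range (2 * i +
    1)).filter (fun s : ℕ => (L : ℤ) ∣ ((s : ℤ) - i - 0)), ((2 * i).choose s : ℝ)) / 4 ^ i ≤ Real.exp 4 * ((∑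
    s ∈ (Finset.range (2 * i + 1)).filter (fun s : ℕ => (L : ℤ) ∣ ((s : ℤ) - i - (n : ℤ))), ((2 * i).choose s
    : ℝ)) / 4 ^ i) :=
  fun L _ _ hn hi hL => TreeRatio.lam_zero_le_exp_four_mul L hn hi hL

end Summit.QuantumFields.YangMills.Theorems.FemtoCurvatureSkewness

end
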